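import Summits.Ventures.PercRepro.RankDistUpSetGirth

/-!
# PercRepro — THE EQUALITY LOCUS OF THEOREM G: below `2u < ρ(E) + girth` the rank level EXCEEDS the size level
unless every member of rank `u` is independent; `C(n, u) = c_u` iff every circuit has more than `u + 1` elements
(p9, gen 22)

`RankDistUpSetGirth` (Theorem G) proves `#{A ∈ P : |A| = u} ≤ #{A ∈ P : ρ(A) = u}` for every up-closed family `P`
of a finite matroid of rank `p` and every `u ≤ p` with `2u ≤ p + g`, `g` a lower bound on the circuit sizes, by the
double counting `|L_ν|·C(p − u + ν, ν) ≤ |R_ν|·C(u + 1 − g, ν)` on the nullity strata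
`L_ν = {A ∈ P : |A| = u, ρ(A) = u − ν}`, `R_ν = {A' ∈ P : ρ(A') = u, |A'| = u + ν}`. This file records that
inequality as such (`card_upSizeLevNull_mul_choose_le_of_girth`, no range needed) and reads its STRICT part: the two
binomials differ as soon as `2u + 2 ≤ p + g + ν`, so **`|L_ν| < |R_ν|` whenever `R_ν ≠ ∅` there**
(`card_upSizeLevNull_lt_card_upRankLevNull_of_girth`), and summing the strata, **in the strict range `2u + 1 ≤ p + g`
the size level is STRICTLY below the rank level as soon as some member of `P` of rank `u` is dependent**
(`card_upSizeLev_lt_card_upRankLev_of_girth`); conversely if every member of rank `u` has exactly `u` elements the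
two levels coincide. Hence the equality locus of Theorem G in the strict range
(`card_upSizeLev_eq_card_upRankLev_iff_of_girth`):
`#{A ∈ P : |A| = u} = #{A ∈ P : ρ(A) = u}` ⟺ every member of `P` of rank `u` is independent.
For `P = ⊤` (the rank distribution `c_u = levelCount M u`): a circuit with at most `u + 1` elements extends to a set
of rank `u` with `u + 1` elements (`exists_rk_eq_ncard_eq_succ_of_circuit`), so **`C(n, u) < c_u` in the strict range
as soon as some circuit has `≤ u + 1` elements** (`choose_lt_levelCount_of_girth`), while
**`c_u = C(n, u)` whenever every circuit has at least `u + 2` elements** (`levelCount_eq_choose_of_circuits`, no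
range needed: the sets of rank `u` are then exactly the `u`-subsets). Together
(`levelCount_eq_choose_iff_of_girth`): for `u ≤ p` with `2u + 1 ≤ p + g`,
**`c_u = C(n, u)` ⟺ every circuit of `M` has at least `u + 2` elements.**
The boundary `2u = p + g` is genuinely different: `U₂,₃ ⊕ U₁,₁` (`n = 4`, `p = 3`, `g = 3`, `u = 3`) has
`c₃ = 4 = C(4, 3)` with a circuit of `3 ≤ u + 1` elements. On the tight layer (`sizeLev` / `shadowLev`) the same
reads: `U_u = s_u` in the strict range iff the dependent part `d_u` of the shadow level vanishes
(`card_sizeLev_eq_card_shadowLev_iff_of_girth`). Nothing here moves any window of the crux.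
-/

namespace PercRepro.RankDist

open Set Finset _root_.Matroid PercRepro.ThmH

variable {α : Type} (M : Matroid α) [M.Finite]

/-! ## The weighted form of Theorem G and its strict part -/

/-- Strict monotonicity of `n ↦ C(n, ν)` for `ν ≥ 1` and `n ≥ ν` at the top: `C(a, ν) < C(b, ν)` for `a < b`,
`ν ≤ b`. -/
lemma choose_lt_choose_of_lt {a b ν : ℕ} (hν : 1 ≤ ν) (hab : a < b) (hνb : ν ≤ b) :
    a.choose ν < b.choose ν := by
  obtain ⟨b', rfl⟩ : ∃ b', b = b' + 1 := ⟨b - 1, by omega⟩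
  obtain ⟨ν', rfl⟩ : ∃ ν', ν = ν' + 1 := ⟨ν - 1, by omega⟩
  calc a.choose (ν' + 1) ≤ b'.choose (ν' + 1) := Nat.choose_le_choose _ (by omega)
    _ < b'.choose ν' + b'.choose (ν' + 1) := by
        have : 0 < b'.choose ν' := Nat.choose_pos (by omega)
        omega
    _ = (b' + 1).choose (ν' + 1) := (Nat.choose_succ_succ b' ν').symm

/-- **The double counting of Theorem G, as an inequality between weighted counts**: for every up-closed `P`,
`1 ≤ ν ≤ u ≤ p`, when every circuit has at least `g` elements,
`|L_ν|·C(p − u + ν, ν) ≤ |R_ν|·C(u + 1 − g, ν)` — no range condition. -/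
theorem card_upSizeLevNull_mul_choose_le_of_girth {P : Set α → Prop} (hP : UpClosed M P) {p g u ν : ℕ}
    (hr : M.eRank = (p : ℕ∞)) (hg : ∀ C, M.IsCircuit C → (g : ℕ∞) ≤ C.encard) (hν : 1 ≤ ν) (hνu : ν ≤ u)
    (hup : u ≤ p) :
    (upSizeLevNull M P u ν).card * (p - u + ν).choose ν
      ≤ (upRankLevNull M P u ν).card * (u + 1 - g).choose ν := by
  classical
  exact Finset.card_mul_le_card_mul (s := upSizeLevNull M P u ν) (t := upRankLevNull M P u ν)
    (fun A A' => A ⊆ A') (fun A hA => card_bipartiteAbove_upRankLevNull_ge M hP hr hνu hup hA)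
    (fun A' hA' => card_bipartiteBelow_upSizeLevNull_le_of_girth M hg hν hA')

/-- **The strict stratified inequality**: `|L_ν| < |R_ν|` whenever `R_ν ≠ ∅` and `2u + 2 ≤ p + g + ν`
(`1 ≤ ν ≤ u ≤ p`, every circuit with at least `g` elements). -/
theorem card_upSizeLevNull_lt_card_upRankLevNull_of_girth {P : Set α → Prop} (hP : UpClosed M P) {p g u ν : ℕ}
    (hr : M.eRank = (p : ℕ∞)) (hg : ∀ C, M.IsCircuit C → (g : ℕ∞) ≤ C.encard) (hν : 1 ≤ ν) (hνu : ν ≤ u)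
    (hup : u ≤ p) (hu : 2 * u + 2 ≤ p + g + ν) (hne : (upRankLevNull M P u ν).Nonempty) :
    (upSizeLevNull M P u ν).card < (upRankLevNull M P u ν).card := by
  have hdc := card_upSizeLevNull_mul_choose_le_of_girth M hP hr hg hν hνu hup
  have hch : (u + 1 - g).choose ν < (p - u + ν).choose ν :=
    choose_lt_choose_of_lt hν (by omega) (by omega)
  have hRpos : 0 < (upRankLevNull M P u ν).card := Finset.card_pos.2 hne
  have h : (upSizeLevNull M P u ν).card * (p - u + ν).choose ν
      < (upRankLevNull M P u ν).card * (p - u + ν).choose ν :=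
    hdc.trans_lt (Nat.mul_lt_mul_of_pos_left hch hRpos)
  exact Nat.lt_of_mul_lt_mul_right h

/-- **Theorem G is STRICT in the strict range**: `u ≤ p`, `2u + 1 ≤ p + g`, every circuit with at least `g`
elements — if some member of the up-set of rank `u` has more than `u` elements (some `R_ν`, `ν ≥ 1`, is nonempty)
then `#{A ∈ P : |A| = u} < #{A ∈ P : ρ(A) = u}`. -/
theorem card_upSizeLev_lt_card_upRankLev_of_girth {P : Set α → Prop} (hP : UpClosed M P) {p g u : ℕ}
    (hr : M.eRank = (p : ℕ∞)) (hg : ∀ C, M.IsCircuit C → (g : ℕ∞) ≤ C.encard) (hup : u ≤ p)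
    (hu : 2 * u + 1 ≤ p + g) (hne : ∃ ν, 1 ≤ ν ∧ (upRankLevNull M P u ν).Nonempty) :
    (upSizeLev M P u).card < (upRankLev M P u).card := by
  obtain ⟨ν₀, hν₀, hne⟩ := hne
  rw [card_upSizeLev_eq_sum]
  have hle : ∀ ν ∈ Finset.range (u + 1), (upSizeLevNull M P u ν).card ≤ (upRankLevNull M P u ν).card := by
    intro ν hν
    rw [Finset.mem_range] at hν
    rcases Nat.eq_zero_or_pos ν with h0 | hpos
    · rw [h0]
      exact Finset.card_le_card (upSizeLevNull_zero_subset M P u)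
    · exact card_upSizeLevNull_le_card_upRankLevNull_of_girth M hP hr hg hpos (by omega) hup (by omega)
  by_cases hν₀u : ν₀ ≤ u
  · have hlt : (upSizeLevNull M P u ν₀).card < (upRankLevNull M P u ν₀).card :=
      card_upSizeLevNull_lt_card_upRankLevNull_of_girth M hP hr hg hν₀ hν₀u hup (by omega) hne
    calc ∑ ν ∈ Finset.range (u + 1), (upSizeLevNull M P u ν).card
        < ∑ ν ∈ Finset.range (u + 1), (upRankLevNull M P u ν).card :=
          Finset.sum_lt_sum hle ⟨ν₀, Finset.mem_range.2 (by omega), hlt⟩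
      _ ≤ (upRankLev M P u).card := sum_card_upRankLevNull_le M P u _
  · have hnot : ν₀ ∉ Finset.range (u + 1) := by
      rw [Finset.mem_range]
      omega
    have hpos : 0 < (upRankLevNull M P u ν₀).card := Finset.card_pos.2 hne
    calc ∑ ν ∈ Finset.range (u + 1), (upSizeLevNull M P u ν).card
        ≤ ∑ ν ∈ Finset.range (u + 1), (upRankLevNull M P u ν).card := Finset.sum_le_sum hle
      _ < ∑ ν ∈ insert ν₀ (Finset.range (u + 1)), (upRankLevNull M P u ν).card := by
          rw [Finset.sum_insert hnot]
          omega
      _ ≤ (upRankLev M P u).card := sum_card_upRankLevNull_le M P u _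

/-- If every member of the up-set of rank `u` has exactly `u` elements, the rank level is the nullity-`0`
stratum and coincides with the size level's nullity-`0` stratum. -/
lemma upRankLev_eq_upSizeLevNull_zero_of_forall {P : Set α → Prop} {u : ℕ}
    (hind : ∀ A ∈ upRankLev M P u, A.ncard = u) : upRankLev M P u = upSizeLevNull M P u 0 := by
  classical
  ext A
  rw [mem_upSizeLevNull, mem_upSizeLev]
  constructor
  · intro hA
    obtain ⟨hAE, hPA, hrk⟩ := (mem_upRankLev M).1 hA
    exact ⟨⟨hAE, hPA, hind A hA⟩, by omega⟩
  · rintro ⟨⟨hAE, hPA, -⟩, hrk⟩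
    rw [mem_upRankLev]
    exact ⟨hAE, hPA, by omega⟩

/-- **THE EQUALITY LOCUS OF THEOREM G** in the strict range `2u + 1 ≤ p + g` (`u ≤ p`, every circuit with at least
`g` elements): `#{A ∈ P : |A| = u} = #{A ∈ P : ρ(A) = u}` iff every member of the up-set of rank `u` is
independent (has exactly `u` elements). -/
theorem card_upSizeLev_eq_card_upRankLev_iff_of_girth {P : Set α → Prop} (hP : UpClosed M P) {p g u : ℕ}
    (hr : M.eRank = (p : ℕ∞)) (hg : ∀ C, M.IsCircuit C → (g : ℕ∞) ≤ C.encard) (hup : u ≤ p)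
    (hu : 2 * u + 1 ≤ p + g) :
    (upSizeLev M P u).card = (upRankLev M P u).card ↔ ∀ A ∈ upRankLev M P u, A.ncard = u := by
  constructor
  · intro heq A hA
    by_contra hne
    obtain ⟨hAE, hPA, hrk⟩ := (mem_upRankLev M).1 hA
    have hle : u ≤ A.ncard := hrk ▸ rk_le_ncard M hAE
    have hlt := card_upSizeLev_lt_card_upRankLev_of_girth M hP hr hg hup hu
      ⟨A.ncard - u, by omega, ⟨A, by
        rw [mem_upRankLevNull]
        exact ⟨hA, by omega⟩⟩⟩
    omega
  · intro hind
    apply le_antisymm (card_upSizeLev_le_card_upRankLev_of_girth M hP hr hg hup (by omega))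
    rw [upRankLev_eq_upSizeLevNull_zero_of_forall M hind, card_upSizeLev_eq_sum]
    exact Finset.single_le_sum (f := fun ν => (upSizeLevNull M P u ν).card) (fun _ _ => Nat.zero_le _)
      (Finset.mem_range.2 (by omega))

/-! ## The rank distribution: `C(n, u) = c_u` iff every circuit has at least `u + 2` elements -/

/-- A circuit with at most `u + 1` elements, `u ≤ ρ(E)`: some set of rank `u` has `u + 1` elements (a basis of the
circuit inside a base, filled up to `u` elements, plus the remaining element of the circuit). -/
lemma exists_rk_eq_ncard_eq_succ_of_circuit {p u : ℕ} (hr : M.eRank = (p : ℕ∞)) (hup : u ≤ p)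
    {C : Set α} (hC : M.IsCircuit C) (hCu : C.encard ≤ u + 1) :
    ∃ A', A' ⊆ M.E ∧ rk M A' = u ∧ A'.ncard = u + 1 := by
  obtain ⟨x, hx⟩ := hC.nonempty
  have hI : M.Indep (C \ {x}) := hC.sdiff_singleton_indep hx
  obtain ⟨B, hB, hIB⟩ := hI.exists_isBase_superset
  have hCfin : C.Finite := M.ground_finite.subset hC.subset_ground
  have hBfin : B.Finite := M.ground_finite.subset hB.subset_ground
  have hBcard : B.ncard = p := by
    have h := hB.encard_eq_eRank
    rw [hr, ← hBfin.cast_ncard_eq] at h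
    exact_mod_cast h
  have hIcard : (C \ {x}).ncard ≤ u := by
    have h1 : (C \ {x}).ncard + 1 = C.ncard := Set.ncard_sdiff_singleton_add_one hx hCfin
    have h2 : C.ncard ≤ u + 1 := by
      rw [← hCfin.cast_ncard_eq] at hCu
      exact_mod_cast hCu
    omega
  obtain ⟨J, hIJ, hJB, hJcard⟩ := Set.exists_subsuperset_card_eq hIB hIcard (by omega : u ≤ B.ncard)
  have hJE : J ⊆ M.E := hJB.trans hB.subset_ground
  have hJindep : M.Indep J := hB.indep.subset hJB
  have hxB : x ∉ B := by
    intro hxB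
    have hCB : C ⊆ B := by
      intro y hy
      by_cases hyx : y = x
      · rw [hyx]
        exact hxB
      · exact hIB ⟨hy, hyx⟩
    exact hC.not_indep (hB.indep.subset hCB)
  have hxJ : x ∉ J := fun h => hxB (hJB h)
  refine ⟨insert x J, Set.insert_subset (hC.subset_ground hx) hJE, ?_, ?_⟩
  · have hxcl : x ∈ M.closure J :=
      M.closure_subset_closure hIJ (hC.mem_closure_sdiff_singleton_of_mem hx)
    rw [rk_insert_of_mem_closure_set M hxcl, rk_eq_iff M hJE, hJindep.eRk_eq_encard,
      ← (hBfin.subset hJB).cast_ncard_eq, hJcard]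
  · rw [Set.ncard_insert_of_notMem hxJ (hBfin.subset hJB), hJcard]

/-- **`C(n, u) < c_u` in the strict range as soon as some circuit has at most `u + 1` elements**: `u ≤ p`,
`2u + 1 ≤ p + g`, every circuit with at least `g` elements, and a circuit `C` with `|C| ≤ u + 1`. -/
theorem choose_lt_levelCount_of_girth {p g u : ℕ} (hr : M.eRank = (p : ℕ∞))
    (hg : ∀ C, M.IsCircuit C → (g : ℕ∞) ≤ C.encard) (hup : u ≤ p) (hu : 2 * u + 1 ≤ p + g)
    {C : Set α} (hC : M.IsCircuit C) (hCu : C.encard ≤ u + 1) :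
    ((gr M).card).choose u < levelCount M u := by
  classical
  have hP : UpClosed M (fun _ => True) := fun _ _ _ _ _ => trivial
  obtain ⟨A', hA'E, hA'rk, hA'card⟩ := exists_rk_eq_ncard_eq_succ_of_circuit M hr hup hC hCu
  have h := card_upSizeLev_lt_card_upRankLev_of_girth M hP hr hg hup hu ⟨1, le_rfl, ⟨A', by
    rw [mem_upRankLevNull, mem_upRankLev]
    exact ⟨⟨hA'E, trivial, hA'rk⟩, hA'card⟩⟩⟩
  rwa [card_upSizeLev_true, card_upRankLev_true] at h

/-- If every circuit has at least `u + 2` elements, the sets of rank `u` are exactly the `u`-subsets of `E`. -/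
lemma upRankLev_true_eq_upSizeLev_true_of_circuits {u : ℕ}
    (hcirc : ∀ C, M.IsCircuit C → ((u + 2 : ℕ) : ℕ∞) ≤ C.encard) :
    upRankLev M (fun _ => True) u = upSizeLev M (fun _ => True) u := by
  classical
  ext A
  rw [mem_upRankLev, mem_upSizeLev]
  constructor
  · rintro ⟨hAE, -, hrk⟩
    refine ⟨hAE, trivial, ?_⟩
    have hAfin : A.Finite := M.ground_finite.subset hAE
    by_contra hne
    have hlt : u < A.ncard := lt_of_le_of_ne (hrk ▸ rk_le_ncard M hAE) (Ne.symm hne)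
    have hdep : M.Dep A := by
      rw [Matroid.dep_iff]
      refine ⟨fun hind => ?_, hAE⟩
      have h := hind.eRk_eq_encard
      rw [eRk_eq_coe_rk M hAE, hrk, ← hAfin.cast_ncard_eq] at h
      have h' : u = A.ncard := by exact_mod_cast h
      omega
    obtain ⟨C, hCA, hC⟩ := hdep.exists_isCircuit_subset
    have h1 := hcirc C hC
    have h2 := hC.eRk_add_one_eq
    have h3 : M.eRk C ≤ M.eRk A := M.eRk_mono hCA
    rw [eRk_eq_coe_rk M hAE, hrk] at h3
    have h4 : ((u + 2 : ℕ) : ℕ∞) ≤ (u : ℕ∞) + 1 := by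
      calc ((u + 2 : ℕ) : ℕ∞) ≤ C.encard := h1
        _ = M.eRk C + 1 := h2.symm
        _ ≤ (u : ℕ∞) + 1 := add_le_add h3 le_rfl
    have h5 : u + 2 ≤ u + 1 := by exact_mod_cast h4
    omega
  · rintro ⟨hAE, -, hcard⟩
    refine ⟨hAE, trivial, ?_⟩
    have hAfin : A.Finite := M.ground_finite.subset hAE
    have hindep : M.Indep A := by
      by_contra hni
      have hdep : M.Dep A := Matroid.dep_iff.2 ⟨hni, hAE⟩
      obtain ⟨C, hCA, hC⟩ := hdep.exists_isCircuit_subset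
      have h1 := hcirc C hC
      have h2 : C.encard ≤ A.encard := Set.encard_le_encard hCA
      rw [← hAfin.cast_ncard_eq, hcard] at h2
      have h3 : u + 2 ≤ u := by exact_mod_cast h1.trans h2
      omega
    rw [rk_eq_iff M hAE, hindep.eRk_eq_encard, ← hAfin.cast_ncard_eq, hcard]

/-- **`c_u = C(n, u)` whenever every circuit has at least `u + 2` elements** (no condition on `u`): the sets of
rank `u` are then exactly the `u`-subsets. -/
theorem levelCount_eq_choose_of_circuits {u : ℕ}
    (hcirc : ∀ C, M.IsCircuit C → ((u + 2 : ℕ) : ℕ∞) ≤ C.encard) :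
    levelCount M u = ((gr M).card).choose u := by
  rw [← card_upRankLev_true, ← card_upSizeLev_true, upRankLev_true_eq_upSizeLev_true_of_circuits M hcirc]

/-- **THE EQUALITY LOCUS OF `C(n, u) ≤ c_u`**: for `u ≤ p` with `2u + 1 ≤ p + g`, `g` a lower bound on the circuit
sizes, `c_u = C(n, u)` iff every circuit of `M` has at least `u + 2` elements. (At the boundary `2u = p + g` this
fails: `U₂,₃ ⊕ U₁,₁` has `c₃ = C(4, 3) = 4` with a triangle.) -/
theorem levelCount_eq_choose_iff_of_girth {p g u : ℕ} (hr : M.eRank = (p : ℕ∞))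
    (hg : ∀ C, M.IsCircuit C → (g : ℕ∞) ≤ C.encard) (hup : u ≤ p) (hu : 2 * u + 1 ≤ p + g) :
    levelCount M u = ((gr M).card).choose u ↔
      ∀ C, M.IsCircuit C → ((u + 2 : ℕ) : ℕ∞) ≤ C.encard := by
  constructor
  · intro heq C hC
    by_contra hlt
    have hCfin : C.Finite := M.ground_finite.subset hC.subset_ground
    have hle : C.encard ≤ u + 1 := by
      rw [← hCfin.cast_ncard_eq] at hlt ⊢
      have h : ¬ (u + 2 ≤ C.ncard) := fun h => hlt (by exact_mod_cast h)
      exact_mod_cast (by omega : C.ncard ≤ u + 1)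
    exact absurd heq (choose_lt_levelCount_of_girth M hr hg hup hu hC hle).ne'
  · exact levelCount_eq_choose_of_circuits M

/-! ## The tight layer: `U_u = s_u` in the strict range iff the dependent part of the shadow level vanishes -/

section Tight

variable [DecidableEq α]

/-- **On the tight layer**, `u ≤ p`, `2u + 1 ≤ p + g`, every circuit with at least `g` elements: the size level
`U_u` of the up-set of the bottom sets equals its shadow level `s_u` iff every member of the shadow level is
independent (the dependent part `d_u` vanishes). -/
theorem card_sizeLev_eq_card_shadowLev_iff_of_girth {p q g u : ℕ} (hr : M.eRank = (p : ℕ∞))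
    (hg : ∀ C, M.IsCircuit C → (g : ℕ∞) ≤ C.encard) (hup : u ≤ p) (hu : 2 * u + 1 ≤ p + g) :
    (sizeLev M p q u).card = (shadowLev M u (PerFlat.Uq M p q)).card ↔
      ∀ A ∈ shadowLev M u (PerFlat.Uq M p q), A.ncard = u := by
  rw [sizeLev_eq_upSizeLev, shadowLev_eq_upRankLev]
  exact card_upSizeLev_eq_card_upRankLev_iff_of_girth M (upClosed_containsBottomSet M p q) hr hg hup hu

end Tight

end PercRepro.RankDist
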